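import Mathlib
import Summits.QuantumFields.BalabanUV.Beta.EriceRemainderEnclosureHistoryAutonomyComparisonAgeCompositionStaticChainStageStep

/-!
# EriceRemainderEnclosureHistoryAutonomyComparisonAgeCompositionStaticChainClosure — (E80b) THE ASSEMBLY: the observer induction over the ages as ONE
# theorem — STATIC CLOSURE OF THE WINDOW-MASS CHAIN OVER EVERY LEVEL-COUPLED CONFIGURATION (route (N′), first order): `0 ≤ ρ_m < 1` at every step

Cell `pub-balaban`, β-function sub-cell, BINDER row D4 «RemainderConst leaves for Bałaban's split» (`HOME/BINDER-OWNERS.md`; owner lineage `b2b-balaban-beta-an4`;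
this file by co-owner #2 lineage `b2b-balaban-beta-d4-p2`, generation 71), β-FLOW TEAM duty (1), FREEZE (0) honoured (def-free; imports (E80a) `…StaticChainStageStep`; nothing restated).

HONEST FRAMING (page 1, verbatim and binding).  *"Discharging BetaPertH makes Bałaban's UV stability UNCONDITIONAL — a real constructive-QFT result; it is
NOT the continuum limit and NOT the Clay problem."*  THIS FILE DISCHARGES NOTHING OF THE KIND.  Finite non-negative linear algebra and finite sums — hypotheses of
a census, not facts; the age profile of Bałaban's (1.22) limit functional is NOT PRINTED ([I] p. 298; GAPS G-t4-U2-1∕-2) and NOT asserted.  Row D4 class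
UNCHANGED (critical-path width 0; instance 0∕1; D4 DISCHARGE NO DATE).  HONEST DEPENDENCY: continuum YM on T⁴ ⇐ BetaPertH ∧ nine spine estimates (0/9 proved);
BetaPertH ⇐ (D1) ∧ (D4) ∧ CAP+tail; G-an2-4 gates asym, D1 and NE2/3/4.

THE POINT (census sense (α); route (N′) of READMEs `g67/e76`–`g70/e79`; this station `HOME/b2b-balaban-beta-d4-p2/g71/e80/README.md`).  Generations 69–70
reduced the first-order STATIC CLOSURE of the window-mass chain over the LEVEL-COUPLED system to the OBSERVER INDUCTION over the ages ((E78a) §3) and proved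
its step inequality (◆) for every pair of scales ((E79zi) `step_lattice_all`).  THIS FILE IS THE ASSEMBLY ((E79) README §5 (1)).  Setting: ages `k_0 > k_1 > … >
k_{M−1} ≥ 1` processed oldest first, loads `x_m ≥ 0` forming a LEVEL-COUPLED FEASIBLE configuration (positive levels `a_i ≥ 1 + Σ_l G_{il}a_l`, `G_{il} =
2x_lS(k_l,k_i)∕k_l`, `S(K,j) = Σ_{t<j}√(K∕(K+t+1))`; (E76b)); the static chain `ρ_m = x̃_m(1 + Σ_{i<m}θ_{m,i}b_{m,i})∕(1 − Ω_m)`, `b_{m+1,m} = ρ_m∕(1−ρ_m)`,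
`b_{m+1,i} = b_{m,i}∕(1−ρ_m)` ((E72a)) with ANY data dominated by the configuration: `0 ≤ x̃_m ≤ x_m`, `0 ≤ θ_{m,i} ≤ θ̄(k_i∕k_m)` (`θ̄(q) = 1 −
(q∕(q+1))^{3∕2}e^{−1∕(2q)}`, (E72c)), `Ω_m ≤ Σ_{i<m} x_i k_m∕k_i` (the window mass, (E74a)) — so no separate majorant argument ((E72a) §3) is needed to apply it.
**`lc_static_closure`: THEN `0 ≤ ρ_m < 1` AT EVERY STEP `m < M`.**  Proof = the induction `stage_zero`∕`stage_succ` on the number `j` of processed ages,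
carrying (∃) the EXACT LEVELS of the processed system and its EXACT RESPONSES to the reads of every scale `k_m` (rebuilt at each step by bordering, (E80a)
`exact_levels_succ`∕`response_succ`, the pivot being positive on the feasible set by (E78b) `pivot_pos` — feasibility of every initial segment is the
restriction of the configuration's), the ratios `ρ_i ∈ [0,1)`, the carried ratios `b ≥ 0`, and THE OBSERVER BOUNDS `1 + Σ_{i<j}θ_{m,i}b_{j,i} ≤ (1 +
2κΨ_j(m))(1 − Ω_j(m))` (`κ = 31∕40`; `Ψ_j(m) = Σ_{l<j}G_{ml}c^{(m)}_l`, `Ω_j(m) = Σ_{l<j}x_lk_m∕k_l`) for every later scale `k_m`: the next age's ratio is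
bounded AT ITS OWN SCALE ((E78a) `ratio_le_ratio_bar`, `ratio_bar_le_one_sub_pivot`: `ρ_j ≤ x_j(1+2κΨ_yy) ≤ 1 − D_j < 1`, the window mass being `< 1` because
the observer bound dominates `N ≥ 1`), and every later bound propagates by (E80a) `observer_propagate` fed with (◆) = (E80a) `step_lattice`.  So route (N′)'s
FIRST-ORDER STATIC CLOSURE OVER THE LEVEL-COUPLED SYSTEM IS A TREE THEOREM ABOUT THE CONFIGURATION — every level-coupled feasible load profile at integer
ages, every admissible defect and window-mass data.  WHAT REMAINS for route (N′): the identification with the flow at a pin (levels `a_k = (h_0∕h_k)²`,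
loads `2x_k = L_k k h_k³`; (E76b) `load_budget_levels_at_pin` ∕ (E77d) pattern), MONO∕MONO′, and the nonlinear route (N).  NOT CLAIMED: anything about
Bałaban's flow; anything nonlinear; anything printed.

WHAT IS PROVED ([folklore]; 0 `def`, 0 sorry).  `stage_zero`, **`stage_succ`**, **`lc_static_closure`**; (append, same generation) **`lc_window_mass_lt_one`**
(the window mass `Σ_{i<m}x_ik_m∕k_i < 1` at every step — exported for (E80d)'s Harnack step).
-/
noncomputable section
open Finset

namespace Summit.QuantumFields.BalabanUV.Beta.EriceRemainderEnclosureHistoryAutonomyComparisonAgeCompositionStaticChainClosure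

open Summit.QuantumFields.BalabanUV.Beta.EriceRemainderEnclosureHistoryAutonomyComparisonAgeCompositionStaticChainCertificate
open Summit.QuantumFields.BalabanUV.Beta.EriceRemainderEnclosureHistoryAutonomyComparisonAgeCompositionStaticChainResolvent
open Summit.QuantumFields.BalabanUV.Beta.EriceRemainderEnclosureHistoryAutonomyComparisonAgeCompositionStaticChainStageStep

/-! ## THE OBSERVER INDUCTION OVER THE AGES, and static closure of the window-mass chain over the level-coupled system -/

section Induction

variable {M j : ℕ} {k : ℕ → ℕ} {x ρ af xt Ω : ℕ → ℝ} {θ b G : ℕ → ℕ → ℝ}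

/-- **BASE.**  Before any age is processed every clause of the induction is vacuous or an equality (`N = 1`, `Ψ = Ω = 0`). [folklore] -/
theorem stage_zero :
    ∃ (a : ℕ → ℝ) (c : ℕ → ℕ → ℝ), ((∀ i, i < 0 → 0 < a i) ∧
      (∀ i, i < 0 → a i = 1 + ∑ l ∈ range (0), G i l * a l) ∧
      (∀ m, m < M → ∀ i, i < 0 → c m i = (∑ t ∈ range (k i), Real.sqrt ((k m : ℝ) / ((k m : ℝ) + t + 1))) / (k m : ℝ) + ∑ l ∈ range (0), G i l * c m l) ∧
      (∀ m, m < M → ∀ i, i < 0 → 0 ≤ c m i) ∧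
      (∀ i, i < 0 → 0 ≤ ρ i ∧ ρ i < 1) ∧
      (∀ i, i < 0 → 0 ≤ b (0) i) ∧
      (∀ m, 0 ≤ m → m < M → 1 + ∑ i ∈ range (0), θ m i * b (0) i ≤
        (1 + 2 * (31/40:ℝ) * ∑ l ∈ range (0), G m l * c m l) * (1 - ∑ l ∈ range (0), x l * (k m : ℝ) / (k l : ℝ)))) := by
  refine ⟨fun _ => 0, fun _ _ => 0, ?_, ?_, ?_, ?_, ?_, ?_, ?_⟩
  · intro i hi; omega
  · intro i hi; omega
  · intro m _ i hi; omega
  · intro m _ i hi; omega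
  · intro i hi; omega
  · intro i hi; omega
  · intro m _ _; simp

/-- **STEP.**  Processing the next age `y = k_j` (load `u = x_j`): the Schur pivot is positive on the feasible set ((E78b) `pivot_pos`), so the ratio
bound `ρ_j ≤ u(1 + 2κΨ_yy) ≤ 1 − D_j < 1` follows from the observer bound AT THE AGE'S OWN SCALE ((E78a) `ratio_le_ratio_bar`,
`ratio_bar_le_one_sub_pivot`); exact levels and responses of the enlarged system come from §3; and for every later scale `z = k_m` the observer
bound propagates by (◆) (§1 `step_lattice`, i.e. (E79zi) `step_lattice_all`) through `observer_propagate`. [folklore] -/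
theorem stage_succ
    (hG : ∀ i l, G i l = 2 * x l * (∑ t ∈ range (k i), Real.sqrt ((k l : ℝ) / ((k l : ℝ) + t + 1))) / (k l : ℝ))
    (hk : ∀ m, m < M → 1 ≤ k m) (hkk : ∀ i m, i < m → m < M → k m + 1 ≤ k i)
    (hx : ∀ m, m < M → 0 ≤ x m)
    (hθ : ∀ m i, i < m → m < M → 0 ≤ θ m i ∧ θ m i ≤ 1 - ((k i : ℝ) / (k m)) / (((k i : ℝ) / (k m)) + 1) * Real.sqrt (((k i : ℝ) / (k m)) / (((k i : ℝ) / (k m)) + 1)) * Real.exp (-(1 / (2 * ((k i : ℝ) / (k m))))))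
    (haf0 : ∀ i, i < M → 0 < af i) (haf : ∀ i, i < M → 1 + ∑ l ∈ range M, G i l * af l ≤ af i)
    (hxt : ∀ m, m < M → 0 ≤ xt m ∧ xt m ≤ x m) (hΩ : ∀ m, m < M → Ω m ≤ ∑ i ∈ range m, x i * (k m : ℝ) / (k i : ℝ))
    (hρ : ∀ m, m < M → ρ m = xt m * (1 + ∑ i ∈ range m, θ m i * b m i) / (1 - Ω m))
    (hnew : ∀ m, m < M → b (m + 1) m = ρ m / (1 - ρ m)) (hold : ∀ m i, i < m → m < M → b (m + 1) i = b m i / (1 - ρ m))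
    (hjM : j < M)
    (ih : ∃ (a : ℕ → ℝ) (c : ℕ → ℕ → ℝ), ((∀ i, i < j → 0 < a i) ∧
      (∀ i, i < j → a i = 1 + ∑ l ∈ range (j), G i l * a l) ∧
      (∀ m, m < M → ∀ i, i < j → c m i = (∑ t ∈ range (k i), Real.sqrt ((k m : ℝ) / ((k m : ℝ) + t + 1))) / (k m : ℝ) + ∑ l ∈ range (j), G i l * c m l) ∧
      (∀ m, m < M → ∀ i, i < j → 0 ≤ c m i) ∧
      (∀ i, i < j → 0 ≤ ρ i ∧ ρ i < 1) ∧
      (∀ i, i < j → 0 ≤ b (j) i) ∧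
      (∀ m, j ≤ m → m < M → 1 + ∑ i ∈ range (j), θ m i * b (j) i ≤
        (1 + 2 * (31/40:ℝ) * ∑ l ∈ range (j), G m l * c m l) * (1 - ∑ l ∈ range (j), x l * (k m : ℝ) / (k l : ℝ))))) :
    ∃ (a : ℕ → ℝ) (c : ℕ → ℕ → ℝ), ((∀ i, i < j + 1 → 0 < a i) ∧
      (∀ i, i < j + 1 → a i = 1 + ∑ l ∈ range (j + 1), G i l * a l) ∧
      (∀ m, m < M → ∀ i, i < j + 1 → c m i = (∑ t ∈ range (k i), Real.sqrt ((k m : ℝ) / ((k m : ℝ) + t + 1))) / (k m : ℝ) + ∑ l ∈ range (j + 1), G i l * c m l) ∧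
      (∀ m, m < M → ∀ i, i < j + 1 → 0 ≤ c m i) ∧
      (∀ i, i < j + 1 → 0 ≤ ρ i ∧ ρ i < 1) ∧
      (∀ i, i < j + 1 → 0 ≤ b (j + 1) i) ∧
      (∀ m, j + 1 ≤ m → m < M → 1 + ∑ i ∈ range (j + 1), θ m i * b (j + 1) i ≤
        (1 + 2 * (31/40:ℝ) * ∑ l ∈ range (j + 1), G m l * c m l) * (1 - ∑ l ∈ range (j + 1), x l * (k m : ℝ) / (k l : ℝ)))) := by
  obtain ⟨a, c, ha0, ha, hc, hc0, hρ01, hb0, hH⟩ := ih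
  have hy1 : 1 ≤ k j := hk j hjM
  have hy0 : (0 : ℝ) < (k j : ℝ) := by exact_mod_cast hy1
  have hxj : 0 ≤ x j := hx j hjM
  have hx' : ∀ l, l < j + 1 → 0 ≤ x l := fun l hl => hx l (by omega)
  have hxM : ∀ l, l < M → 0 ≤ x l := hx
  have hGnn : ∀ i l, i < j + 1 → l < j + 1 → 0 ≤ G i l := lc_array_nonneg hG hx'
  have hGnnM : ∀ i l, i < M → l < M → 0 ≤ G i l := lc_array_nonneg hG hxM
  -- the return amplification of the new age's reads and the Schur pivot of its row
  set Ψyy : ℝ := ∑ l ∈ range j, G j l * c j l with hΨyy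
  set D : ℝ := 1 - G j j - 2 * x j * Ψyy with hD
  have hΨyy0 : 0 ≤ Ψyy := sum_nonneg fun l hl =>
    mul_nonneg (hGnn j l (Nat.lt_succ_self j) (Nat.lt_succ_of_lt (mem_range.mp hl))) (hc0 j hjM l (mem_range.mp hl))
  -- feasibility of the enlarged system, restricted from the whole configuration
  have hrestrict : ∀ i, i < j + 1 → 1 + ∑ l ∈ range (j + 1), G i l * af l ≤ af i := by
    intro i hi
    have h1 := haf i (by omega)
    have h2 : ∑ l ∈ range (j + 1), G i l * af l ≤ ∑ l ∈ range M, G i l * af l :=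
      sum_le_sum_of_subset_of_nonneg (range_subset_range.mpr (Nat.succ_le_of_lt hjM)) fun l hl _ =>
        mul_nonneg (hGnnM i l (by omega) (mem_range.mp hl)) (haf0 l (mem_range.mp hl)).le
    linarith
  have hD0 : 0 < D := by
    refine pivot_pos (n := j) (G := G) (φ := fun i => (∑ t ∈ range (k i), Real.sqrt ((k j : ℝ) / ((k j : ℝ) + t + 1))) / (k j : ℝ)) (e := fun l => G j l) (g := G j j)
      (xy2 := 2 * x j) (a' := af) (ay' := af j) (c := c j) (D := D)
      (fun i l hi hl => hGnn i l (by omega) (by omega)) (fun i _ => by positivity)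
      (fun l hl => hGnn j l (Nat.lt_succ_self j) (by omega)) (hGnn j j (Nat.lt_succ_self j) (Nat.lt_succ_self j))
      (by positivity) (fun i hi => haf0 i (by omega)) (haf0 j hjM) ?_ ?_ (hc j hjM) (hc0 j hjM) (by rw [hD, hΨyy])
    · intro i hi
      have h := hrestrict i (by omega)
      rw [sum_range_succ, hG i j] at h
      have : 2 * x j * ((∑ t ∈ range (k i), Real.sqrt ((k j : ℝ) / ((k j : ℝ) + t + 1))) / (k j : ℝ)) * af j
          = 2 * x j * (∑ t ∈ range (k i), Real.sqrt ((k j : ℝ) / ((k j : ℝ) + t + 1))) / (k j : ℝ) * af j := by ring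
      linarith
    · have h := hrestrict j (Nat.lt_succ_self j)
      rw [sum_range_succ] at h
      linarith
  -- the self-read and the cap
  have hs : 1 / 2 ≤ (∑ t ∈ range (k j), Real.sqrt ((k j : ℝ) / ((k j : ℝ) + t + 1))) / (k j : ℝ) := self_read_ge_half hy1
  have hGjj : G j j = 2 * x j * ((∑ t ∈ range (k j), Real.sqrt ((k j : ℝ) / ((k j : ℝ) + t + 1))) / (k j : ℝ)) := by rw [hG]; ring
  have hcap : 2 * x j * ((∑ t ∈ range (k j), Real.sqrt ((k j : ℝ) / ((k j : ℝ) + t + 1))) / (k j : ℝ) + Ψyy) < 1 := by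
    have : D = 1 - 2 * x j * ((∑ t ∈ range (k j), Real.sqrt ((k j : ℝ) / ((k j : ℝ) + t + 1))) / (k j : ℝ) + Ψyy) := by rw [hD, hGjj]; ring
    linarith
  -- the ratio of the new age from the observer bound at its own scale
  have hNy1 : 1 ≤ 1 + ∑ i ∈ range j, θ j i * b j i := by
    have : 0 ≤ ∑ i ∈ range j, θ j i * b j i :=
      sum_nonneg fun i hi => mul_nonneg (hθ j i (mem_range.mp hi) hjM).1 (hb0 i (mem_range.mp hi))
    linarith
  have hHy := hH j le_rfl hjM
  have hΩy1 : ∑ l ∈ range j, x l * (k j : ℝ) / (k l : ℝ) < 1 := by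
    by_contra hcon
    have hcon' : 1 - ∑ l ∈ range j, x l * (k j : ℝ) / (k l : ℝ) ≤ 0 := by linarith
    have h1 : (1 + 2 * (31/40:ℝ) * Ψyy) * (1 - ∑ l ∈ range j, x l * (k j : ℝ) / (k l : ℝ)) ≤ 0 :=
      mul_nonpos_of_nonneg_of_nonpos (by positivity) hcon'
    linarith
  have hρj := hρ j hjM
  have hxtj := hxt j hjM
  have hΩj := hΩ j hjM
  have hρle' : ρ j ≤ x j * (1 + ∑ i ∈ range j, θ j i * b j i) / (1 - ∑ l ∈ range j, x l * (k j : ℝ) / (k l : ℝ)) := by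
    rw [hρj]
    exact div_le_div₀ (mul_nonneg hxj (by linarith)) (mul_le_mul_of_nonneg_right hxtj.2 (by linarith)) (by linarith) (by linarith)
  have hρle : ρ j ≤ x j * (1 + 2 * (31/40:ℝ) * Ψyy) := hρle'.trans (ratio_le_ratio_bar hxj hΩy1 hHy)
  have hρb1 : x j * (1 + 2 * (31/40:ℝ) * Ψyy) < 1 := by
    have h1 := ratio_bar_le_one_sub_pivot (κ := (31/40:ℝ)) hxj hΨyy0 (by norm_num) hs
    linarith
  have hρ0 : 0 ≤ ρ j := by
    rw [hρj]; exact div_nonneg (mul_nonneg hxtj.1 (by linarith)) (by linarith)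
  have hρ1 : ρ j < 1 := lt_of_le_of_lt hρle hρb1
  -- exact levels and exact responses of the enlarged system
  obtain ⟨a', ha'0, ha'⟩ := exact_levels_succ hG hx' ha0 ha (hc j hjM) (hc0 j hjM) (by rw [hD, hΨyy]) hD0
  have hresp : ∀ m, m < M → ∃ c' : ℕ → ℝ, (∀ i, i < j + 1 → 0 ≤ c' i) ∧
      (∀ i, i < j + 1 → c' i = (∑ t ∈ range (k i), Real.sqrt ((k m : ℝ) / ((k m : ℝ) + t + 1))) / (k m : ℝ) + ∑ l ∈ range (j + 1), G i l * c' l) ∧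
      (∀ f : ℕ → ℝ, ∑ l ∈ range (j + 1), f l * c' l = ∑ l ∈ range j, f l * c m l +
        (2 * x j * (∑ l ∈ range j, f l * c j l) + f j) * ((∑ t ∈ range (k j), Real.sqrt ((k m : ℝ) / ((k m : ℝ) + t + 1))) / (k m : ℝ) + ∑ l ∈ range j, G j l * c m l) / D) :=
    fun m hm => response_succ (k m) hG hx' (hc j hjM) (hc0 j hjM) (hc m hm) (hc0 m hm) (by rw [hD, hΨyy]) hD0
  choose! c' hc' using hresp
  refine ⟨a', c', ha'0, ha', fun m hm => (hc' m hm).2.1, fun m hm => (hc' m hm).1, ?_, ?_, ?_⟩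
  · -- ratios
    intro i hi
    rcases Nat.lt_succ_iff_lt_or_eq.mp hi with h | h
    · exact hρ01 i h
    · subst h; exact ⟨hρ0, hρ1⟩
  · -- carried ratios
    exact carried_nonneg_succ (hnew j hjM) (fun i hi => hold j i hi hjM) hρ0 hρ1 hb0
  · -- THE OBSERVER BOUND AT EVERY LATER SCALE
    intro m hjm hmM
    have hz1 : 1 ≤ k m := hk m hmM
    have hzy : k m + 1 ≤ k j := hkk j m (by omega) hmM
    have hkl : ∀ l, l < j → k j + 1 ≤ k l := fun l hl => hkk l j hl hjM
    have hHm := hH m (by omega) hmM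
    have hNm1 : 1 ≤ 1 + ∑ i ∈ range j, θ m i * b j i := by
      have : 0 ≤ ∑ i ∈ range j, θ m i * b j i :=
        sum_nonneg fun i hi => mul_nonneg (hθ m i (by have := mem_range.mp hi; omega) hmM).1 (hb0 i (mem_range.mp hi))
      linarith
    have hθmj := hθ m j (by omega) hmM
    -- (◆) for the pair (k_j, k_m) above the processed configuration
    have hdia := step_lattice (n := j) (y := k j) (z := k m) (k := k) (x := x) (a := a) (cy := c j) (cz := c m)
      (Sy := fun l => (∑ t ∈ range (k j), Real.sqrt ((k l : ℝ) / ((k l : ℝ) + t + 1)))) (Sz := fun l => (∑ t ∈ range (k m), Real.sqrt ((k l : ℝ) / ((k l : ℝ) + t + 1))))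
      (Ry := fun l => (∑ t ∈ range (k l), Real.sqrt ((k j : ℝ) / ((k j : ℝ) + t + 1)))) (Rz := fun l => (∑ t ∈ range (k l), Real.sqrt ((k m : ℝ) / ((k m : ℝ) + t + 1))))
      (θ := θ m j) (xy := x j) (Ψyy := Ψyy) (Ψyz := ∑ l ∈ range j, G m l * c j l) (Ψzy := ∑ l ∈ range j, G j l * c m l)
      (Ψzz := ∑ l ∈ range j, G m l * c m l) (Ωz := ∑ l ∈ range j, x l * (k m : ℝ) / (k l : ℝ))
      (σ := (∑ t ∈ range (k m), Real.sqrt ((k j : ℝ) / ((k j : ℝ) + t + 1))) / (k j : ℝ)) (φ := (∑ t ∈ range (k j), Real.sqrt ((k m : ℝ) / ((k m : ℝ) + t + 1))) / (k m : ℝ)) (s := (∑ t ∈ range (k j), Real.sqrt ((k j : ℝ) / ((k j : ℝ) + t + 1))) / (k j : ℝ))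
      hz1 hzy hkl (fun l hl => hx' l (by omega)) (fun _ _ => rfl) (fun _ _ => rfl) (fun _ _ => rfl) (fun _ _ => rfl) ha0
      (fun i hi => by rw [ha i hi]; exact congrArg _ (sum_congr rfl fun l _ => by rw [hG]))
      (fun i hi => by rw [hc j hjM i hi]; exact congrArg _ (sum_congr rfl fun l _ => by rw [hG]))
      (fun i hi => by rw [hc m hmM i hi]; exact congrArg _ (sum_congr rfl fun l _ => by rw [hG]))
      (by rw [hΨyy]; exact sum_congr rfl fun l _ => by rw [hG])
      (sum_congr rfl fun l _ => by rw [hG]) (sum_congr rfl fun l _ => by rw [hG]) (sum_congr rfl fun l _ => by rw [hG])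
      rfl rfl rfl rfl hθmj.2 hxj hcap
    have hfun := (hc' m hmM).2.2 (fun l => G m l)
    have hN' := numerator_succ (θ := θ) (m := m) (hnew j hjM) (fun i hi => hold j i hi hjM) hρ1
    have hGmj : G m j = 2 * x j * ((∑ t ∈ range (k m), Real.sqrt ((k j : ℝ) / ((k j : ℝ) + t + 1))) / (k j : ℝ)) := by rw [hG]; ring
    refine observer_propagate (q := (k j : ℝ) / (k m : ℝ)) hθmj.1 hNm1 hHm hρle hρb1 hN' hdia hfun hGmj hD hGjj ?_
    rw [sum_range_succ, div_div_eq_mul_div]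

/-- **STATIC CLOSURE OF THE WINDOW-MASS CHAIN OVER THE LEVEL-COUPLED SYSTEM (route (N′), first order).**  Ages `k_0 > k_1 > … > k_{M−1} ≥ 1`
processed oldest first with loads `x_m ≥ 0`; defects `0 ≤ θ_{m,i} ≤ θ̄(k_i∕k_m)`, `θ̄(q) = 1 − (q∕(q+1))^{3∕2}e^{−1∕(2q)}`; the static chain
`ρ_m = x_m(1 + Σ_{i<m} θ_{m,i} b_{m,i})∕(1 − Ω_m)` with the WINDOW MASS `Ω_m = Σ_{i<m} x_i k_m∕k_i` and the carried ratios
`b_{m+1,m} = ρ_m∕(1−ρ_m)`, `b_{m+1,i} = b_{m,i}∕(1−ρ_m)`; and the configuration LEVEL-COUPLED feasible: positive levels `a` with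
`a_i ≥ 1 + Σ_l (2x_l S(k_l,k_i)∕k_l) a_l`, `S(K,j) = Σ_{t<j} √(K∕(K+t+1))`.  THEN THE CHAIN CLOSES: `0 ≤ ρ_m < 1` at every step.
Proof: the observer induction (`stage_zero`, `stage_succ`) with `κ = 31∕40`. [folklore] -/
theorem lc_static_closure {k : ℕ → ℕ} {x : ℕ → ℝ}
    (hk : ∀ m, m < M → 1 ≤ k m) (hkk : ∀ i m, i < m → m < M → k m + 1 ≤ k i)
    (hθ : ∀ m i, i < m → m < M → 0 ≤ θ m i ∧ θ m i ≤ 1 - ((k i : ℝ) / (k m)) / (((k i : ℝ) / (k m)) + 1) * Real.sqrt (((k i : ℝ) / (k m)) / (((k i : ℝ) / (k m)) + 1)) * Real.exp (-(1 / (2 * ((k i : ℝ) / (k m))))))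
    (hfeas : ∃ a : ℕ → ℝ, (∀ i, i < M → 0 < a i) ∧
      ∀ i, i < M → 1 + ∑ l ∈ range M, (2 * x l * (∑ t ∈ range (k i), Real.sqrt ((k l : ℝ) / ((k l : ℝ) + t + 1))) / (k l : ℝ)) * a l ≤ a i)
    (hxt : ∀ m, m < M → 0 ≤ xt m ∧ xt m ≤ x m) (hΩ : ∀ m, m < M → Ω m ≤ ∑ i ∈ range m, x i * (k m : ℝ) / (k i : ℝ))
    (hρ : ∀ m, m < M → ρ m = xt m * (1 + ∑ i ∈ range m, θ m i * b m i) / (1 - Ω m))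
    (hnew : ∀ m, m < M → b (m + 1) m = ρ m / (1 - ρ m)) (hold : ∀ m i, i < m → m < M → b (m + 1) i = b m i / (1 - ρ m)) :
    ∀ m, m < M → 0 ≤ ρ m ∧ ρ m < 1 := by
  obtain ⟨af, haf0, haf⟩ := hfeas
  have hx : ∀ m, m < M → 0 ≤ x m := fun m hm => (hxt m hm).1.trans (hxt m hm).2
  let G : ℕ → ℕ → ℝ := fun i l => 2 * x l * (∑ t ∈ range (k i), Real.sqrt ((k l : ℝ) / ((k l : ℝ) + t + 1))) / (k l : ℝ)
  have hG : ∀ i l, G i l = 2 * x l * (∑ t ∈ range (k i), Real.sqrt ((k l : ℝ) / ((k l : ℝ) + t + 1))) / (k l : ℝ) := fun _ _ => rfl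
  have hstage : ∀ j, j ≤ M → ∃ (a : ℕ → ℝ) (c : ℕ → ℕ → ℝ), ((∀ i, i < j → 0 < a i) ∧
      (∀ i, i < j → a i = 1 + ∑ l ∈ range (j), G i l * a l) ∧
      (∀ m, m < M → ∀ i, i < j → c m i = (∑ t ∈ range (k i), Real.sqrt ((k m : ℝ) / ((k m : ℝ) + t + 1))) / (k m : ℝ) + ∑ l ∈ range (j), G i l * c m l) ∧
      (∀ m, m < M → ∀ i, i < j → 0 ≤ c m i) ∧
      (∀ i, i < j → 0 ≤ ρ i ∧ ρ i < 1) ∧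
      (∀ i, i < j → 0 ≤ b (j) i) ∧
      (∀ m, j ≤ m → m < M → 1 + ∑ i ∈ range (j), θ m i * b (j) i ≤
        (1 + 2 * (31/40:ℝ) * ∑ l ∈ range (j), G m l * c m l) * (1 - ∑ l ∈ range (j), x l * (k m : ℝ) / (k l : ℝ)))) := by
    intro j
    induction j with
    | zero => intro _; exact stage_zero
    | succ j ih =>
      intro hj
      exact stage_succ hG hk hkk hx hθ haf0 haf hxt hΩ hρ hnew hold (by omega) (ih (by omega))
  intro m hm
  obtain ⟨a, c, -, -, -, -, hρ01, -, -⟩ := hstage (m + 1) (by omega)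
  exact hρ01 m (Nat.lt_succ_self m)

/-- **THE WINDOW MASS STAYS BELOW ONE.**  Under the hypotheses of `lc_static_closure`, at every step `m < M` the window mass of the processed ages seen from
the next age is `Σ_{i<m} x_ik_m∕k_i < 1` — because the observer bound at the age's own scale dominates the chain's numerator `N ≥ 1`:
`1 ≤ N ≤ (1 + 2κΨ)(1 − Ω)` forces `1 − Ω > 0`.  (Exported for the sandwich wiring (E80d), whose Harnack step divides by `1 − Ω`.) [folklore] -/
theorem lc_window_mass_lt_one {k : ℕ → ℕ} {x : ℕ → ℝ}
    (hk : ∀ m, m < M → 1 ≤ k m) (hkk : ∀ i m, i < m → m < M → k m + 1 ≤ k i)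
    (hθ : ∀ m i, i < m → m < M → 0 ≤ θ m i ∧ θ m i ≤ 1 - ((k i : ℝ) / (k m)) / (((k i : ℝ) / (k m)) + 1) * Real.sqrt (((k i : ℝ) / (k m)) / (((k i : ℝ) / (k m)) + 1)) * Real.exp (-(1 / (2 * ((k i : ℝ) / (k m))))))
    (hfeas : ∃ a : ℕ → ℝ, (∀ i, i < M → 0 < a i) ∧
      ∀ i, i < M → 1 + ∑ l ∈ range M, (2 * x l * (∑ t ∈ range (k i), Real.sqrt ((k l : ℝ) / ((k l : ℝ) + t + 1))) / (k l : ℝ)) * a l ≤ a i)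
    (hxt : ∀ m, m < M → 0 ≤ xt m ∧ xt m ≤ x m) (hΩ : ∀ m, m < M → Ω m ≤ ∑ i ∈ range m, x i * (k m : ℝ) / (k i : ℝ))
    (hρ : ∀ m, m < M → ρ m = xt m * (1 + ∑ i ∈ range m, θ m i * b m i) / (1 - Ω m))
    (hnew : ∀ m, m < M → b (m + 1) m = ρ m / (1 - ρ m)) (hold : ∀ m i, i < m → m < M → b (m + 1) i = b m i / (1 - ρ m)) :
    ∀ m, m < M → ∑ i ∈ range m, x i * (k m : ℝ) / (k i : ℝ) < 1 := by
  obtain ⟨af, haf0, haf⟩ := hfeas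
  have hx : ∀ m, m < M → 0 ≤ x m := fun m hm => (hxt m hm).1.trans (hxt m hm).2
  let G : ℕ → ℕ → ℝ := fun i l => 2 * x l * (∑ t ∈ range (k i), Real.sqrt ((k l : ℝ) / ((k l : ℝ) + t + 1))) / (k l : ℝ)
  have hG : ∀ i l, G i l = 2 * x l * (∑ t ∈ range (k i), Real.sqrt ((k l : ℝ) / ((k l : ℝ) + t + 1))) / (k l : ℝ) := fun _ _ => rfl
  have hstage : ∀ j, j ≤ M → ∃ (a : ℕ → ℝ) (c : ℕ → ℕ → ℝ), ((∀ i, i < j → 0 < a i) ∧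
      (∀ i, i < j → a i = 1 + ∑ l ∈ range (j), G i l * a l) ∧
      (∀ m, m < M → ∀ i, i < j → c m i = (∑ t ∈ range (k i), Real.sqrt ((k m : ℝ) / ((k m : ℝ) + t + 1))) / (k m : ℝ) + ∑ l ∈ range (j), G i l * c m l) ∧
      (∀ m, m < M → ∀ i, i < j → 0 ≤ c m i) ∧
      (∀ i, i < j → 0 ≤ ρ i ∧ ρ i < 1) ∧
      (∀ i, i < j → 0 ≤ b (j) i) ∧
      (∀ m, j ≤ m → m < M → 1 + ∑ i ∈ range (j), θ m i * b (j) i ≤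
        (1 + 2 * (31/40:ℝ) * ∑ l ∈ range (j), G m l * c m l) * (1 - ∑ l ∈ range (j), x l * (k m : ℝ) / (k l : ℝ)))) := by
    intro j
    induction j with
    | zero => intro _; exact stage_zero
    | succ j ih =>
      intro hj
      exact stage_succ hG hk hkk hx hθ haf0 haf hxt hΩ hρ hnew hold (by omega) (ih (by omega))
  intro m hm
  obtain ⟨a, c, -, -, -, hc0, -, hb0, hH⟩ := hstage m hm.le
  have hHm := hH m le_rfl hm
  have hN1 : 1 ≤ 1 + ∑ i ∈ range m, θ m i * b m i := by
    have : 0 ≤ ∑ i ∈ range m, θ m i * b m i :=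
      sum_nonneg fun i hi => mul_nonneg (hθ m i (mem_range.mp hi) hm).1 (hb0 i (mem_range.mp hi))
    linarith
  have hΨ0 : 0 ≤ ∑ l ∈ range m, G m l * c m l :=
    sum_nonneg fun l hl => mul_nonneg (lc_array_nonneg hG hx m l hm (by have := mem_range.mp hl; omega)) (hc0 m hm l (mem_range.mp hl))
  by_contra hcon
  have hcon' : 1 - ∑ i ∈ range m, x i * (k m : ℝ) / (k i : ℝ) ≤ 0 := by linarith
  have h1 : (1 + 2 * (31/40:ℝ) * ∑ l ∈ range m, G m l * c m l) * (1 - ∑ l ∈ range m, x l * (k m : ℝ) / (k l : ℝ)) ≤ 0 :=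
    mul_nonpos_of_nonneg_of_nonpos (by positivity) hcon'
  linarith

end Induction

end Summit.QuantumFields.BalabanUV.Beta.EriceRemainderEnclosureHistoryAutonomyComparisonAgeCompositionStaticChainClosure

end
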